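import Summits.MatrixMultiplication.OmegaCensus.STPPSmallPatternKernelBits

/-!
# ω-census, small STPP pattern `(2,1,1)^k`: kernel search — the difference model and the search invariant

HONEST FRAMING (pub-omega census; verbatim): lottery ticket; floor = certified bounds/negative ranges.
Census STRUCTURE bookkeeping of the STPP track (seat pub-omega-stpp-3, gen 23; STRUCTURE row B5, the threshold column
`T1(H) = max {k : (2,1,1)^k ⊆ H}` — its LOWER sides as kernel theorems), not progress on `ω`: small patterns in small groups
bound no exponent.

Second of three reflection files for `STPPSmallPatternKernelSearch.lean`:
* §4 the `(2,1,1)` DIFFERENCE MODEL `ModelD p q c` (disjunctive form of the right-hand side of the tree's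
  `exists_isSTPP_211_iff`, `STPPSmallPatternCriteria.lean`), the NORMAL FORM `NF` (codes of `c` increasing, `pᵢ` coded below
  `qᵢ`), and the INVARIANT `InvM m S`: the nine masks of a search state under-approximate (in the sense of `MSub`) the aggregates
  `U, E, Fc, V, W, X, Cm, NCm` of the first `m` triples of a solution — with its consequences «the solution's next `c`, `p`, `q`
  have clear bits in the forbidden masks» (`fc_free`, `mc_free`, `dm_free`, …);
* §5–7 the two ROOM tests pass along a solution (`hasBits_future_c`, `hasBits_future_pairs`: the future `c`'s resp. pair
  elements are enough free codes), the unfolding equations of `child` / `level`, and THE CHILD UPDATE `invM_childSt`: the state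
  built by `child` from the codes of the `m`-th triple satisfies the invariant for `m + 1`.

References: H. Cohn, R. Kleinberg, B. Szegedy, C. Umans, *Group-theoretic algorithms for matrix multiplication*, FOCS 2005
(arXiv:math/0511460), Def. 5.1.  Record: pub-omega HOME `pub-omega-stpp-3-g23/` (engine mirror `k211v3.py`, counts, kernel timings).
-/

namespace Summit.MatrixMultiplication.OmegaCensus

namespace STPP211Neg

/-! ## 4. The difference model, its normal form, and the search invariant -/

section Model

variable {G : Type} [AddCommGroup G] (E : GEnc G) {K : ℕ} (p q c : Fin K → G)

/-- Membership in the `i`-th pair `Aᵢ = {pᵢ, qᵢ}`. -/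
def InA (i : Fin K) (x : G) : Prop := x = p i ∨ x = q i

/-- THE `(2,1,1)` DIFFERENCE MODEL (disjunctive form of the right-hand side of the tree's `exists_isSTPP_211_iff`):
`pᵢ ≠ qᵢ`, the pairs are pairwise disjoint, and `x − y ≠ cⱼ − c_l` for `x ∈ Aᵢ`, `y ∈ A_l`, `j ≠ l`. -/
def ModelD : Prop :=
  (∀ i, p i ≠ q i) ∧ (∀ i l x, i ≠ l → InA p q i x → InA p q l x → False) ∧
    (∀ i j l x y, j ≠ l → InA p q i x → InA p q l y → x - y ≠ c j - c l)

/-- NORMAL FORM (the part used along the search): codes of `c` strictly increasing, `pᵢ` coded below `qᵢ`. -/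
def NF : Prop := (∀ i j : Fin K, i < j → E.enc (c i) < E.enc (c j)) ∧ (∀ i, E.enc (p i) < E.enc (q i))

/-- THE INVARIANT: the masks of the state `S` under-approximate the aggregates of the first `m` triples of the solution. -/
structure InvM (m : ℕ) (S : St) : Prop where
  /-- `U ⊆ ⋃_{i<m} Aᵢ` -/
  hU : MSub E S.U fun x => ∃ i : Fin K, i.val < m ∧ InA p q i x
  /-- `E ⊆ ⋃ (A_l + cⱼ − c_l)` -/
  hE : MSub E S.E fun x => ∃ j l : Fin K, j.val < m ∧ l.val < m ∧ j ≠ l ∧ ∃ y, InA p q l y ∧ x = y + (c j - c l)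
  /-- `Fc ⊆ ⋃ (c_l + (U − A_l))` -/
  hFc : MSub E S.Fc fun z => ∃ l i : Fin K, l.val < m ∧ i.val < m ∧ ∃ x y, InA p q i x ∧ InA p q l y ∧
    z = c l + (x - y)
  /-- `V ⊆ ⋃ (U − cⱼ)` -/
  hV : MSub E S.V fun x => ∃ j i : Fin K, j.val < m ∧ i.val < m ∧ ∃ u, InA p q i u ∧ x = u - c j
  /-- `W ⊆ ⋃ (A_l − c_l)` -/
  hW : MSub E S.W fun x => ∃ l : Fin K, l.val < m ∧ ∃ y, InA p q l y ∧ x = y - c l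
  /-- `X ⊆ ⋃ (c_l − A_l)` -/
  hX : MSub E S.X fun x => ∃ l : Fin K, l.val < m ∧ ∃ y, InA p q l y ∧ x = c l - y
  /-- `Cm ⊆ {cⱼ}` -/
  hCm : MSub E S.Cm fun x => ∃ j : Fin K, j.val < m ∧ x = c j
  /-- `NCm ⊆ {−cⱼ}` -/
  hNCm : MSub E S.NCm fun x => ∃ j : Fin K, j.val < m ∧ x = -c j

/-- The empty state satisfies the invariant with `m = 0`. -/
theorem invM_empty : InvM E p q c 0 St.empty :=
  ⟨MSub_zero E _, MSub_zero E _, MSub_zero E _, MSub_zero E _, MSub_zero E _, MSub_zero E _, MSub_zero E _,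
    MSub_zero E _⟩

variable {E p q c}

omit [AddCommGroup G] in
/-- `pᵢ ∈ Aᵢ`. -/ theorem inA_p (i : Fin K) : InA p q i (p i) := Or.inl rfl
omit [AddCommGroup G] in
/-- `qᵢ ∈ Aᵢ`. -/ theorem inA_q (i : Fin K) : InA p q i (q i) := Or.inr rfl

/-- In a model the `c`'s are pairwise distinct. -/
theorem ModelD.c_ne (hM : ModelD p q c) {j l : Fin K} (hjl : j ≠ l) : c j ≠ c l := by
  intro h
  exact hM.2.2 l j l (p l) (p l) hjl (inA_p l) (inA_p l) (by rw [h, sub_self, sub_self])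

/-- FREE `c`: a code bit of a future `cⱼ` (`j ≥ m`) is clear in `Fc`. -/
theorem InvM.fc_free {m : ℕ} {S : St} (hS : InvM E p q c m S) (hM : ModelD p q c) (j : Fin K) (hj : m ≤ j.val) :
    S.Fc.testBit (E.enc (c j)) = false := by
  refine hS.hFc.testBit_eq_false ?_
  rintro ⟨l, i, hl, -, x, y, hx, hy, h⟩
  have hjl : j ≠ l := fun e => by rw [e] at hj; omega
  exact hM.2.2 i j l x y hjl hx hy (by rw [h]; abel)

/-- FREE PAIR ROOM: a code bit of a future pair element (`z ∈ Aⱼ`, `j ≥ m`) is clear in `U` … -/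
theorem InvM.u_free {m : ℕ} {S : St} (hS : InvM E p q c m S) (hM : ModelD p q c) (j : Fin K) (hj : m ≤ j.val)
    {z : G} (hz : InA p q j z) : S.U.testBit (E.enc z) = false := by
  refine hS.hU.testBit_eq_false ?_
  rintro ⟨i, hi, hiz⟩
  exact hM.2.1 i j z (fun e => by rw [e] at hi; omega) hiz hz

/-- … and in `E`. -/
theorem InvM.e_free {m : ℕ} {S : St} (hS : InvM E p q c m S) (hM : ModelD p q c) (j : Fin K)
    {z : G} (hz : InA p q j z) : S.E.testBit (E.enc z) = false := by
  refine hS.hE.testBit_eq_false ?_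
  rintro ⟨j', l, -, -, hjl, y, hy, h⟩
  exact hM.2.2 j j' l z y hjl hz hy (by rw [h]; abel)

/-- … and in `c + V` for the current `c = c_m`. -/
theorem InvM.v_free {m : ℕ} {S : St} (hS : InvM E p q c m S) (hM : ModelD p q c) (im : Fin K) (him : im.val = m)
    {z : G} (hz : InA p q im z) : (E.g.tr S.V (E.enc (c im))).testBit (E.enc z) = false := by
  refine (MSub_tr E hS.hV (c im)).testBit_eq_false ?_
  rintro ⟨x, ⟨j, i, hj, -, u, hu, rfl⟩, h⟩
  have hjm : j ≠ im := fun e => by rw [e, him] at hj; omega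
  exact hM.2.2 i j im u z hjm hu hz (by rw [h]; abel)

/-- … and in `c + W`. -/
theorem InvM.w_free {m : ℕ} {S : St} (hS : InvM E p q c m S) (hM : ModelD p q c) (im : Fin K) (him : im.val = m)
    {z : G} (hz : InA p q im z) : (E.g.tr S.W (E.enc (c im))).testBit (E.enc z) = false := by
  refine (MSub_tr E hS.hW (c im)).testBit_eq_false ?_
  rintro ⟨x, ⟨l, hl, y, hy, rfl⟩, h⟩
  have hlm : im ≠ l := fun e => by rw [← e, him] at hl; omega
  exact hM.2.2 im im l z y hlm hz hy (by rw [h]; abel)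

/-- The translate `(V ∪ W) + c` in one mask. -/
theorem InvM.vw_free {m : ℕ} {S : St} (hS : InvM E p q c m S) (hM : ModelD p q c) (im : Fin K) (him : im.val = m)
    {z : G} (hz : InA p q im z) : (E.g.tr (Nat.lor S.V S.W) (E.enc (c im))).testBit (E.enc z) = false := by
  have hVW : MSub E (Nat.lor S.V S.W) (fun x => (∃ j i : Fin K, j.val < m ∧ i.val < m ∧ ∃ u, InA p q i u ∧
      x = u - c j) ∨ ∃ l : Fin K, l.val < m ∧ ∃ y, InA p q l y ∧ x = y - c l) :=
    MSub_lor' E hS.hV hS.hW (fun _ h => Or.inl h) (fun _ h => Or.inr h)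
  refine (MSub_tr E hVW (c im)).testBit_eq_false ?_
  rintro ⟨x, hx | hx, h⟩
  · obtain ⟨j, i, hj, -, u, hu, rfl⟩ := hx
    have hjm : j ≠ im := fun e => by rw [e, him] at hj; omega
    exact hM.2.2 i j im u z hjm hu hz (by rw [h]; abel)
  · obtain ⟨l, hl, y, hy, rfl⟩ := hx
    have hlm : im ≠ l := fun e => by rw [← e, him] at hl; omega
    exact hM.2.2 im im l z y hlm hz hy (by rw [h]; abel)

/-- The mask `Mc = U ∪ E ∪ ((V ∪ W) + c)` misses the new pair. -/
theorem InvM.mc_free {m : ℕ} {S : St} (hS : InvM E p q c m S) (hM : ModelD p q c) (im : Fin K) (him : im.val = m)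
    {z : G} (hz : InA p q im z) :
    (Nat.lor (Nat.lor S.U S.E) (E.g.tr (Nat.lor S.V S.W) (E.enc (c im)))).testBit (E.enc z) = false := by
  rw [lor_eq, lor_eq, Nat.testBit_lor, Nat.testBit_lor, hS.u_free hM im (le_of_eq him.symm) hz, hS.e_free hM im hz,
    hS.vw_free hM im him hz]; rfl

/-- The mask `Dm + p` (`Dm = {±(c − cⱼ)}`) misses `q`: `q − p ∉ {±(c − cⱼ)}`. -/
theorem InvM.dm_free {m : ℕ} {S : St} (hS : InvM E p q c m S) (hM : ModelD p q c) (im : Fin K) (him : im.val = m) :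
    (E.g.tr (Nat.lor (E.g.tr S.NCm (E.enc (c im))) (E.g.tr S.Cm (E.g.neg (E.enc (c im))))) (E.enc (p im))).testBit
      (E.enc (q im)) = false := by
  rw [E.neg_enc]
  have hD : MSub E (Nat.lor (E.g.tr S.NCm (E.enc (c im))) (E.g.tr S.Cm (E.enc (-c im))))
      (fun x => ∃ j : Fin K, j.val < m ∧ (x = c im - c j ∨ x = c j - c im)) := by
    refine MSub_lor' E (MSub_tr E hS.hNCm (c im)) (MSub_tr E hS.hCm (-c im)) ?_ ?_
    · rintro x ⟨y, ⟨j, hj, rfl⟩, rfl⟩; exact ⟨j, hj, Or.inl (by abel)⟩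
    · rintro x ⟨y, ⟨j, hj, rfl⟩, rfl⟩; exact ⟨j, hj, Or.inr (by abel)⟩
  refine (MSub_tr E hD (p im)).testBit_eq_false ?_
  rintro ⟨x, ⟨j, hj, hx⟩, h⟩
  have hjm : j ≠ im := fun e => by rw [e, him] at hj; omega
  rcases hx with rfl | rfl
  · exact hM.2.2 im j im (p im) (q im) hjm (inA_p im) (inA_q im) (by rw [h]; abel)
  · exact hM.2.2 im j im (q im) (p im) hjm (inA_q im) (inA_p im) (by rw [h]; abel)

end Model

section Main

variable {G : Type} [AddCommGroup G] {E : GEnc G} {K : ℕ} {p q c : Fin K → G}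

/-! ## 5. One step of the search along the solution: the child update and the room tests -/

/-- Index arithmetic helper: an index below `m + 1` is below `m` or is the new index. -/
theorem lt_succ_cases {m : ℕ} {i im : Fin K} (him : im.val = m) (hi : i.val < m + 1) : i.val < m ∨ i = im := by
  rcases Nat.lt_succ_iff_lt_or_eq.1 hi with h | h
  · exact Or.inl h
  · exact Or.inr (Fin.ext (by rw [h, him]))

/-- The new pair as a mask `P = bit p ||| bit q`. -/
theorem msub_P (E : GEnc G) (p q : Fin K → G) (im : Fin K) :
    MSub E (Nat.lor (bit (E.enc (p im))) (bit (E.enc (q im)))) (fun x => InA p q im x) :=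
  MSub_lor E (MSub_bit E (inA_p im)) (MSub_bit E (inA_q im))

/-- ROOM TEST 1: the future `c`'s are `r` free codes — as a finset of shifted positions. -/
theorem hasBits_future_c (hM : ModelD p q c) (hNF : NF E p q c) {m r : ℕ} (hmr : m + 1 + r = K) (im : Fin K)
    (him : im.val = m) {F : ℕ} (s : ℕ) (hF : ∀ j : Fin K, m < j.val → F.testBit (E.enc (c j)) = true)
    (hs : s ≤ E.enc (c im) + 1) : hasBits r (Nat.shiftRight F s) = true := by
  classical
  let f : Fin r → ℕ := fun t => E.enc (c ⟨m + 1 + t.val, by omega⟩) - s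
  have hgt : ∀ t : Fin r, s ≤ E.enc (c ⟨m + 1 + t.val, by omega⟩) := fun t =>
    le_trans hs (Nat.succ_le_of_lt (hNF.1 im ⟨m + 1 + t.val, by omega⟩
      (by rw [Fin.lt_def, him]; show m < m + 1 + t.val; omega)))
  have hinj : Function.Injective f := by
    intro t t' h
    have h1 := hgt t; have h2 := hgt t'
    have : E.enc (c ⟨m + 1 + t.val, by omega⟩) = E.enc (c ⟨m + 1 + t'.val, by omega⟩) := by
      simp only [f] at h; omega
    have := hM.c_ne.mt (not_not.2 (E.enc_inj this))
    simp only [ne_eq, Fin.mk.injEq, not_not] at this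
    exact Fin.ext (by omega)
  refine hasBits_of_card _ r (Finset.univ.image f) ?_ ?_
  · intro x hx
    obtain ⟨t, -, rfl⟩ := Finset.mem_image.1 hx
    rw [shiftRight_eq', Nat.testBit_shiftRight]
    have := hF ⟨m + 1 + t.val, by omega⟩ (by show m < m + 1 + t.val; omega)
    simp only [f]
    rw [Nat.add_sub_cancel' (hgt t)]; exact this
  · rw [Finset.card_image_of_injective _ hinj, Finset.card_univ, Fintype.card_fin]

/-- ROOM TEST 2: the future pair elements are `2 r` free codes. -/
theorem hasBits_future_pairs (hM : ModelD p q c) {m r : ℕ} (hmr : m + 1 + r = K) {F : ℕ}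
    (hF : ∀ j : Fin K, m < j.val → ∀ z, InA p q j z → F.testBit (E.enc z) = true) :
    hasBits (Nat.mul 2 r) F = true := by
  classical
  let idx : Fin r → Fin K := fun t => ⟨m + 1 + t.val, by omega⟩
  have hidx : ∀ t t', idx t = idx t' → t = t' := by
    intro t t' e; simp only [idx, Fin.mk.injEq] at e; exact Fin.ext (by omega)
  let g : Fin r × Bool → G := fun tb => bif tb.2 then q (idx tb.1) else p (idx tb.1)
  have hgA : ∀ tb, InA p q (idx tb.1) (g tb) := by
    rintro ⟨t, b⟩; cases b
    · exact Or.inl rfl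
    · exact Or.inr rfl
  have hinj : Function.Injective (fun tb => E.enc (g tb)) := by
    rintro ⟨t, b⟩ ⟨t', b'⟩ h
    have h' : g (t, b) = g (t', b') := E.enc_inj h
    by_cases htt : t = t'
    · subst htt
      have hpq := hM.1 (idx t)
      cases b <;> cases b'
      · rfl
      · exact absurd (h' : p (idx t) = q (idx t)) hpq
      · exact absurd ((h' : q (idx t) = p (idx t)).symm) hpq
      · rfl
    · exact (hM.2.1 (idx t) (idx t') (g (t, b)) (fun e => htt (hidx t t' e)) (hgA (t, b)) (h' ▸ hgA (t', b'))).elim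
  refine hasBits_of_card _ _ (Finset.univ.image fun tb => E.enc (g tb)) ?_ ?_
  · intro x hx
    obtain ⟨tb, -, rfl⟩ := Finset.mem_image.1 hx
    exact hF (idx tb.1) (by show m < m + 1 + tb.1.val; omega) _ (hgA tb)
  · rw [Finset.card_image_of_injective _ hinj, Finset.card_univ, Fintype.card_prod, Fintype.card_fin,
      Fintype.card_bool, mul_eq']
    omega


/-! ## 6. Named pieces of `child` / `level` and their unfolding equations -/

/-- The state built by `child`. -/
def childSt (g : GC) (S : St) (c p q Wc Uc CmC : ℕ) : St :=
  ⟨c, Nat.lor S.U (Nat.lor (bit p) (bit q)),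
    Nat.lor (Nat.lor (Nat.lor S.E Wc) (g.tr CmC p)) (g.tr CmC q),
    Nat.lor (Nat.lor (Nat.lor (Nat.lor S.Fc (g.tr S.X p)) (g.tr S.X q))
      (g.tr (Nat.lor S.U (Nat.lor (bit p) (bit q))) (g.sub c p))) (g.tr (Nat.lor S.U (Nat.lor (bit p) (bit q))) (g.sub c q)),
    Nat.lor (Nat.lor (Nat.lor (Nat.lor (Nat.lor S.V (g.tr S.NCm p)) (g.tr S.NCm q)) Uc) (bit (g.sub p c)))
      (bit (g.sub q c)),
    Nat.lor (Nat.lor S.W (bit (g.sub p c))) (bit (g.sub q c)),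
    Nat.lor (Nat.lor S.X (bit (g.sub c p))) (bit (g.sub c q)),
    Nat.lor S.Cm (bit c), Nat.lor S.NCm (bit (g.neg c))⟩

/-- The free-`c` mask tested in `child` (after the new `Fc`). -/
def childFreeC (g : GC) (S : St) (c p q Wc Uc CmC : ℕ) : ℕ :=
  Nat.xor g.full (Nat.lor (childSt g S c p q Wc Uc CmC).Fc (Nat.land (lowMask (Nat.add c 1)) g.full))

/-- The pair-room mask tested in `child`. -/
def childRoom (g : GC) (S : St) (c p q Wc Uc CmC : ℕ) : ℕ :=
  Nat.xor g.full (Nat.lor (childSt g S c p q Wc Uc CmC).U (childSt g S c p q Wc Uc CmC).E)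

/-- `child` unfolded. -/
theorem child_eq (g : GC) (S : St) (r c p q Wc Uc CmC : ℕ) (k : St → Bool) :
    child g S r c p q Wc Uc CmC k = (!(hasBits r (childFreeC g S c p q Wc Uc CmC)) ||
      (!(hasBits (Nat.mul 2 r) (childRoom g S c p q Wc Uc CmC)) || k (childSt g S c p q Wc Uc CmC))) := by
  unfold child; simp only [force_eq]; rfl

/-- The free-`c` mask of `level`. -/
def freeCOf (g : GC) (S : St) : ℕ := Nat.xor g.full (Nat.lor S.Fc (Nat.land (lowMask (Nat.add S.last 1)) g.full))

/-- The mask `Mc` of `level`. -/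
def mcOf (g : GC) (S : St) (c : ℕ) : ℕ := Nat.lor (Nat.lor S.U S.E) (g.tr (Nat.lor S.V S.W) c)

/-- The mask `Dm` of `level`. -/
def dmOf (g : GC) (S : St) (c : ℕ) : ℕ := Nat.lor (g.tr S.NCm c) (g.tr S.Cm (g.neg c))

/-- The free-`q` mask of `level`. -/
def freeQOf (g : GC) (S : St) (c p : ℕ) : ℕ :=
  Nat.xor g.full (Nat.lor (Nat.lor (mcOf g S c) (g.tr (dmOf g S c) p)) (Nat.land (lowMask (Nat.add p 1)) g.full))

/-- The body of the `c`-loop of `level` after the two cheap tests. -/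
noncomputable def cBody (g : GC) (S : St) (r : ℕ) (k : St → Bool) (c : ℕ) : Bool :=
  Nat.beq (Nat.xor g.full (mcOf g S c)) 0 ||
    allBits (Nat.xor g.full (mcOf g S c)) (fun p =>
      allBits (freeQOf g S c p) (fun q => child g S r c p q (g.tr S.W c) (g.tr S.U (g.neg c)) (g.tr S.Cm (g.neg c)) k)
        (freeQOf g S c p))
      (Nat.xor g.full (mcOf g S c))

/-- `level` unfolded. -/
theorem level_eq (g : GC) (S : St) (r x1 : ℕ) (k : St → Bool) :
    level g S r x1 k = allBits (freeCOf g S) (fun c => Nat.testBit x1 c ||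
      !(hasBits r (Nat.shiftRight (freeCOf g S) (Nat.add c 1))) || cBody g S r k c) (freeCOf g S) := by
  unfold level cBody; simp only [force_eq]; rfl

/-! ## 7. The child state satisfies the invariant; the room tests pass; the branch of the solution is not refuted -/

/-- THE CHILD UPDATE: from the invariant for `m` triples and the per-`c` translates, the state built by `child` from the
codes of the `m`-th triple satisfies the invariant for `m + 1` triples. -/
theorem invM_childSt (hNF : NF E p q c) {m : ℕ} (im : Fin K) (him : im.val = m) {S : St} (hS : InvM E p q c m S)
    {Wc Uc CmC : ℕ} (hWc : MSub E Wc fun z => ∃ l : Fin K, l.val < m ∧ ∃ y, InA p q l y ∧ z = y - c l + c im)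
    (hUc : MSub E Uc fun z => ∃ i : Fin K, i.val < m ∧ ∃ u, InA p q i u ∧ z = u - c im)
    (hCmC : MSub E CmC fun z => ∃ j : Fin K, j.val < m ∧ z = c j - c im) :
    InvM E p q c (m + 1) (childSt E.g S (E.enc (c im)) (E.enc (p im)) (E.enc (q im)) Wc Uc CmC) := by
  have _ := hNF
  have hP := msub_P E p q im
  have hU2 : MSub E (Nat.lor S.U (Nat.lor (bit (E.enc (p im))) (bit (E.enc (q im)))))
      (fun x => ∃ i : Fin K, i.val < m + 1 ∧ InA p q i x) :=
    MSub_lor' E hS.hU hP (fun x ⟨i, hi, h⟩ => ⟨i, by omega, h⟩) (fun x h => ⟨im, by omega, h⟩)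
  constructor
  · exact hU2
  · -- E
    simp only [childSt]
    refine MSub_lor' E (MSub_lor' E (MSub_lor' E hS.hE hWc ?_ ?_) (MSub_tr E hCmC (p im)) (fun _ h => h) ?_)
      (MSub_tr E hCmC (q im)) (fun _ h => h) ?_
    · rintro x ⟨j, l, hj, hl, hjl, y, hy, rfl⟩; exact ⟨j, l, by omega, by omega, hjl, y, hy, rfl⟩
    · rintro x ⟨l, hl, y, hy, rfl⟩
      exact ⟨im, l, by omega, by omega, fun e => by rw [← e, him] at hl; omega, y, hy, by abel⟩
    · rintro x ⟨z, ⟨j, hj, rfl⟩, rfl⟩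
      exact ⟨j, im, by omega, by omega, fun e => by rw [e, him] at hj; omega, p im, inA_p im, by abel⟩
    · rintro x ⟨z, ⟨j, hj, rfl⟩, rfl⟩
      exact ⟨j, im, by omega, by omega, fun e => by rw [e, him] at hj; omega, q im, inA_q im, by abel⟩
  · -- Fc
    simp only [childSt]
    rw [E.sub_enc, E.sub_enc]
    refine MSub_lor' E (MSub_lor' E (MSub_lor' E (MSub_lor' E hS.hFc (MSub_tr E hS.hX (p im)) ?_ ?_)
      (MSub_tr E hS.hX (q im)) (fun _ h => h) ?_) (MSub_tr E hU2 (c im - p im)) (fun _ h => h) ?_)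
      (MSub_tr E hU2 (c im - q im)) (fun _ h => h) ?_
    · rintro z ⟨l, i, hl, hi, x, y, hx, hy, rfl⟩; exact ⟨l, i, by omega, by omega, x, y, hx, hy, rfl⟩
    · rintro z ⟨w, ⟨l, hl, y, hy, rfl⟩, rfl⟩
      exact ⟨l, im, by omega, by omega, p im, y, inA_p im, hy, by abel⟩
    · rintro z ⟨w, ⟨l, hl, y, hy, rfl⟩, rfl⟩
      exact ⟨l, im, by omega, by omega, q im, y, inA_q im, hy, by abel⟩
    · rintro z ⟨x, ⟨i, hi, hx⟩, rfl⟩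
      exact ⟨im, i, by omega, hi, x, p im, hx, inA_p im, by abel⟩
    · rintro z ⟨x, ⟨i, hi, hx⟩, rfl⟩
      exact ⟨im, i, by omega, hi, x, q im, hx, inA_q im, by abel⟩
  · -- V
    simp only [childSt]
    rw [E.sub_enc, E.sub_enc]
    refine MSub_lor' E (MSub_lor' E (MSub_lor' E (MSub_lor' E (MSub_lor' E hS.hV (MSub_tr E hS.hNCm (p im)) ?_ ?_)
      (MSub_tr E hS.hNCm (q im)) (fun _ h => h) ?_) hUc (fun _ h => h) ?_)
      (MSub_bit E (x := p im - c im) ⟨im, im, by omega, by omega, p im, inA_p im, rfl⟩) (fun _ h => h) (fun _ h => h))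
      (MSub_bit E (x := q im - c im) ⟨im, im, by omega, by omega, q im, inA_q im, rfl⟩) (fun _ h => h) (fun _ h => h)
    · rintro x ⟨j, i, hj, hi, u, hu, rfl⟩; exact ⟨j, i, by omega, by omega, u, hu, rfl⟩
    · rintro x ⟨z, ⟨j, hj, rfl⟩, rfl⟩; exact ⟨j, im, by omega, by omega, p im, inA_p im, by abel⟩
    · rintro x ⟨z, ⟨j, hj, rfl⟩, rfl⟩; exact ⟨j, im, by omega, by omega, q im, inA_q im, by abel⟩
    · rintro x ⟨i, hi, u, hu, rfl⟩; exact ⟨im, i, by omega, by omega, u, hu, rfl⟩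
  · -- W
    simp only [childSt]
    rw [E.sub_enc, E.sub_enc]
    refine MSub_lor' E (MSub_lor' E hS.hW (MSub_bit E (x := p im - c im) ⟨im, by omega, p im, inA_p im, rfl⟩) ?_
      (fun _ h => h)) (MSub_bit E (x := q im - c im) ⟨im, by omega, q im, inA_q im, rfl⟩) (fun _ h => h) (fun _ h => h)
    rintro x ⟨l, hl, y, hy, rfl⟩; exact ⟨l, by omega, y, hy, rfl⟩
  · -- X
    simp only [childSt]
    rw [E.sub_enc, E.sub_enc]
    refine MSub_lor' E (MSub_lor' E hS.hX (MSub_bit E (x := c im - p im) ⟨im, by omega, p im, inA_p im, rfl⟩) ?_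
      (fun _ h => h)) (MSub_bit E (x := c im - q im) ⟨im, by omega, q im, inA_q im, rfl⟩) (fun _ h => h) (fun _ h => h)
    rintro x ⟨l, hl, y, hy, rfl⟩; exact ⟨l, by omega, y, hy, rfl⟩
  · -- Cm
    simp only [childSt]
    exact MSub_lor' E hS.hCm (MSub_bit E (x := c im) ⟨im, by omega, rfl⟩)
      (fun x ⟨j, hj, h⟩ => ⟨j, by omega, h⟩) (fun _ h => h)
  · -- NCm
    simp only [childSt]
    rw [E.neg_enc]
    exact MSub_lor' E hS.hNCm (MSub_bit E (x := -c im) ⟨im, by omega, rfl⟩)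
      (fun x ⟨j, hj, h⟩ => ⟨j, by omega, h⟩) (fun _ h => h)

end Main

end STPP211Neg

end Summit.MatrixMultiplication.OmegaCensus
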